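import Summits.CriticalPhenomena.Ising3DConformalLimit.Theses.PersistenceSpeed

/-!
# VET REPLICA of the registered birth skeleton of crux stmt-CriticalPhenomena-18094
`PersistenceSpeed.BoundedBoundarySignal` (skeleton sha 8cabd3ec…, by
planner-plan-novel-CriticalPhenomena-Ising3DCon-3ad144fc-v2-g19-0, 2026-08-17T12:47:09Z).

The planner's file is not readable from this jail; the three stub statements below are copied
VERBATIM from the gate's registration (`ledger workitem get stmt-CriticalPhenomena-18094 --json`,
payload.stubs), the local abbreviation `mPlus N x = ⟨σ_x⟩⁺_{box 3 N; β_c(3), 0}` is reconstructed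
from the crux statement, and the composition `BoundedBoundarySignal_of` is the vetter's OWN
sorry-free proof (independent joint-sufficiency check of the registered stubs).
-/

namespace Summit.CriticalPhenomena.Ising3DConformalLimit.Cruxes.BoundedBoundarySignal.Vet

open Literature.Probability.LatticeModels
open scoped BigOperators

/-- `mPlus N x = ⟨σ_x⟩⁺_{Λ_N; β_c(3), 0}`, the plus-boundary finite-volume magnetisation at `x`
in the centred box of radius `N` on `ℤ³`. -/
noncomputable def mPlus (N : ℕ) (x : Site 3) : ℝ :=
  isingCorr (zdGraph 3) (box 3 N) (criticalBeta 3) 0 BoundaryCondition.plus ({x} : Finset (Site 3))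

/-- registered stub 1 (= item stmt-CriticalPhenomena-15591 `ArmHyperscaling.OneArmHyperscaling`, open). -/
theorem stub_oneArmHyperscaling : ∃ K : ℕ, 1 ≤ K ∧ ∃ C : ℝ, ∀ n : ℕ, 1 ≤ n → (Literature.Probability.LatticeModels.isingCorr (Literature.Probability.LatticeModels.zdGraph 3) (Literature.Probability.LatticeModels.box 3 (K * n)) (Literature.Probability.LatticeModels.criticalBeta 3) 0 Literature.Probability.LatticeModels.BoundaryCondition.plus ({0} : Finset (Literature.Probability.LatticeModels.Site 3))) ^ 2 ≤ C * Literature.Probability.LatticeModels.criticalTwoPoint 3 (Pi.single 0 (2 * (n : ℤ))) := by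
  sorry

/-- registered stub 2 (GKS volume antitonicity + translation: Σ_{x∈Λ_L} ⟨σ_x⟩⁺_{Λ_{(3K₀+1)L}} ≤ |Λ_L|·⟨σ_0⟩⁺_{Λ_{3K₀L}}). -/
theorem stub_plusSumLe (K₀ L : ℕ) (hK : 1 ≤ K₀) (hL : 1 ≤ L) : (∑ x ∈ box 3 L, mPlus ((3 * K₀ + 1) * L) x) ≤ ((box 3 L).card : ℝ) * mPlus (K₀ * (3 * L)) 0 ∧ 0 ≤ mPlus (K₀ * (3 * L)) 0 := by
  sorry

/-- registered stub 3 (Messager–Miracle-Solé / Schrader monotonicity box comparison). -/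
theorem stub_boxSumGe (L : ℕ) (hL : 1 ≤ L) : ((box 3 L).card : ℝ) ^ 2 * criticalTwoPoint 3 (Pi.single 0 (2 * ((3 * L : ℕ) : ℤ))) ≤ ∑ x ∈ box 3 L, ∑ y ∈ box 3 L, criticalTwoPoint 3 (x - y) ∧ 0 ≤ criticalTwoPoint 3 (Pi.single 0 (2 * ((3 * L : ℕ) : ℤ))) := by
  sorry

/-- Vetter's independent composition: the three registered stubs give the crux (K := 3K₀+1,
A := √(max C 0)). -/
theorem BoundedBoundarySignal_of :
    Summit.CriticalPhenomena.Ising3DConformalLimit.Theses.PersistenceSpeed.BoundedBoundarySignal := by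
  obtain ⟨K₀, hK₀, C, hC⟩ := stub_oneArmHyperscaling
  refine ⟨3 * K₀ + 1, by omega, Real.sqrt (max C 0), fun L hL => ?_⟩
  obtain ⟨hsum, hm0⟩ := stub_plusSumLe K₀ L hK₀ hL
  obtain ⟨hbox, hG0⟩ := stub_boxSumGe L hL
  have h1 := hC (3 * L) (by omega)
  set m : ℝ := mPlus (K₀ * (3 * L)) 0 with hm
  set G : ℝ := criticalTwoPoint 3 (Pi.single 0 (2 * ((3 * L : ℕ) : ℤ))) with hG
  set SS : ℝ := ∑ x ∈ box 3 L, ∑ y ∈ box 3 L, criticalTwoPoint 3 (x - y) with hSS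
  set c : ℝ := ((box 3 L).card : ℝ) with hc
  have h1' : m ^ 2 ≤ C * G := by simpa [hm, hG, mPlus] using h1
  have h2 : m ^ 2 ≤ max C 0 * G := h1'.trans (mul_le_mul_of_nonneg_right (le_max_left C 0) hG0)
  have h3 : (c * m) ^ 2 ≤ max C 0 * SS := by
    calc (c * m) ^ 2 = c ^ 2 * m ^ 2 := by ring
      _ ≤ c ^ 2 * (max C 0 * G) := mul_le_mul_of_nonneg_left h2 (sq_nonneg _)
      _ = max C 0 * (c ^ 2 * G) := by ring
      _ ≤ max C 0 * SS := mul_le_mul_of_nonneg_left hbox (le_max_right C 0)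
  have h4 : c * m ≤ Real.sqrt (max C 0 * SS) := (le_abs_self _).trans (Real.abs_le_sqrt h3)
  have h5 : Real.sqrt (max C 0 * SS) = Real.sqrt (max C 0) * Real.sqrt SS :=
    Real.sqrt_mul (le_max_right C 0) SS
  have hsum' : (∑ x ∈ box 3 L, isingCorr (zdGraph 3) (box 3 ((3 * K₀ + 1) * L)) (criticalBeta 3) 0
      BoundaryCondition.plus ({x} : Finset (Site 3))) ≤ c * m := by
    simpa [mPlus, hm, hc] using hsum
  calc (∑ x ∈ box 3 L, isingCorr (zdGraph 3) (box 3 ((3 * K₀ + 1) * L)) (criticalBeta 3) 0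
      BoundaryCondition.plus ({x} : Finset (Site 3))) ≤ c * m := hsum'
    _ ≤ Real.sqrt (max C 0 * SS) := h4
    _ = Real.sqrt (max C 0) * Real.sqrt SS := h5

end Summit.CriticalPhenomena.Ising3DConformalLimit.Cruxes.BoundedBoundarySignal.Vet
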